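import Mathlib.NumberTheory.LucasPrimality
import Mathlib.Data.Nat.Factors
import Mathlib.Data.Nat.Size
import HarnessLib

/-!
# Pratt's succinct certificates of primality (Lucas trees)

Pratt (1975) observed that Lucas's converse of Fermat's little theorem — *`p` is prime iff some
`g` satisfies `g^{p-1} ≡ 1 (mod p)` and `g^{(p-1)/q} ≢ 1 (mod p)` for every prime `q ∣ p − 1`*
(Mathlib: `lucas_primality_iff`) — turns into a polynomial-size, polynomial-time checkable proof of
primality once the primes `q` are themselves certified recursively, because the recursion tree
(the "Lucas tree") of `p` has `O(log p)` vertices. This file is the arithmetic of such certificates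
in the flat "proof-line" format (a list of lines, each prime factor of `p − 1` justified by *some*
line of the list — no tree, no order); everything is in the sub-namespace `Pratt`:

* `Pratt.Line = ℕ × ℕ × List ℕ`: a line `(p, g, qs)` claims "`p` is prime, witnessed by `g` and the
  complete factorisation `qs` of `p − 1` (with multiplicity)";
* `LineValid H (p, g, qs)`: `2 ≤ p`, `g^{p-1} mod p = 1`, `∏ qs = p − 1`, and every `q ∈ qs` lies in
  the set `H` of available primes and has `g^{(p-1)/q} mod p ≠ 1`; `heads ls`; a certificate `ls` is
  valid (`CertValid ls`) when every line is valid with respect to the heads of `ls` itself;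
* **soundness** `CertValid.prime_of_mem`: every head of a valid certificate is prime (strong
  induction on the head — `q ∣ p − 1` forces `q < p` — and `lucas_primality`);
* **completeness** `lines p` (the lines of the Lucas tree of `p`, by recursion on `p`, the
  witness `lucasWitness p` from `reverse_lucas_primality`): `certValid_lines`,
  `mem_heads_lines`;
* **succinctness** (Pratt's count, in the form `2^{#lines + 1} ≤ p²`):
  `two_pow_length_lines_succ_le`, hence `length_lines_lt : #lines < 2 · size p`; and the
  shape of the lines (`mem_lines_iff`: each is `line r`, `0 < r ≤ p`; `lucasWitness_lt`: witness
  `<` head) with the digit count `sum_size_primeFactorsList_lt :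
  Σ_{q ∈ pf n} size q < 2 · size n`, which together bound the bit size of the certificate by
  `O(size p)²`.

The polynomial-time verifier reading such certificates off bit strings, and `FACT ∈ coNP`, are in
`Literature/Computability/QuantumComplexity/PrattMachine.lean` and `FactoringProofs.lean`.

## References

* V. Pratt, *Every prime has a succinct certificate*, SIAM J. Comput. 4 (1975) 214–220 (the
  proof system for primality, its soundness and completeness via Lucas's criterion, and the bound
  on proof length). Not held at the time of writing (acquisition requested); the statements below
  are as reported in the two held sources that follow, which are cited at the individual results.
* R. Crandall, C. Pomerance, *Prime numbers: a computational perspective*, Springer, §4.1.3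
  "Succinct certificates", Thm 4.1.1 (Lucas), Thm 4.1.9 (Pratt; the count `N(p) < lg p` of the
  vertices of the Lucas tree).
* S. Arora, B. Barak, *Computational Complexity: A Modern Approach*, CUP 2009, §2.1, Example 2.3
  and Exercise 2.5 [Pra75].
-/

namespace Literature.NumberTheory.Primality

namespace Pratt

open Nat

/-! ### Lines, validity, soundness -/

/-- A Pratt proof line `(p, g, qs)`: the claim that `p` is prime, with Lucas witness `g` and the
complete prime factorisation `qs` of `p − 1` (with multiplicity). [cite: Pratt1975, pp. 214–220] -/
abbrev Line : Type := ℕ × ℕ × List ℕ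

/-- Validity of a line relative to a set `H` of primes already available: `2 ≤ p`,
`g^{p−1} mod p = 1`, `∏ qs = p − 1`, and each `q ∈ qs` is available and `g^{(p−1)/q} mod p ≠ 1`.
[cite: Pratt1975, pp. 214–220] -/
def LineValid (H : Set ℕ) (l : Line) : Prop :=
  2 ≤ l.1 ∧ l.2.1 ^ (l.1 - 1) % l.1 = 1 ∧ l.2.2.prod = l.1 - 1 ∧
    ∀ q ∈ l.2.2, q ∈ H ∧ l.2.1 ^ ((l.1 - 1) / q) % l.1 ≠ 1

/-- Validity of a line is monotone in the set of available primes. [folklore] -/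
theorem LineValid.mono {H H' : Set ℕ} (h : H ⊆ H') {l : Line} (hl : LineValid H l) : LineValid H' l :=
  ⟨hl.1, hl.2.1, hl.2.2.1, fun q hq => ⟨h (hl.2.2.2 q hq).1, (hl.2.2.2 q hq).2⟩⟩

/-- The heads (claimed primes) of a list of lines. [cite: Pratt1975, pp. 214–220] -/
def heads (ls : List Line) : Set ℕ := {q | ∃ l ∈ ls, l.1 = q}

/-- `heads` is monotone. [folklore] -/
theorem heads_mono {ls ls' : List Line} (h : ls ⊆ ls') : heads ls ⊆ heads ls' :=
  fun _ ⟨l, hl, hq⟩ => ⟨l, h hl, hq⟩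

/-- The head of a member is a head. [folklore] -/
theorem mem_heads_of_mem {ls : List Line} {l : Line} (h : l ∈ ls) : l.1 ∈ heads ls := ⟨l, h, rfl⟩

/-- A **valid Pratt certificate**: every line is valid with respect to the heads of the certificate
itself (each prime factor used is certified by some line — in any position). [cite: Pratt1975, pp. 214–220] -/
def CertValid (ls : List Line) : Prop := ∀ l ∈ ls, LineValid (heads ls) l

/-- From `g ^ e % p = 1` to `(g : ZMod p) ^ e = 1`. [folklore] -/
theorem zmod_pow_eq_one_of_mod {p g e : ℕ} (h : g ^ e % p = 1) : (g : ZMod p) ^ e = 1 := by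
  rw [← Nat.cast_pow, ← ZMod.natCast_mod, h, Nat.cast_one]

/-- From `(g : ZMod p) ^ e = 1` to `g ^ e % p = 1`, for `2 ≤ p`. [folklore] -/
theorem mod_eq_one_of_zmod_pow {p g e : ℕ} (hp : 2 ≤ p) (h : (g : ZMod p) ^ e = 1) : g ^ e % p = 1 := by
  rw [← Nat.cast_pow, ← Nat.cast_one, ZMod.natCast_eq_natCast_iff'] at h
  rwa [Nat.mod_eq_of_lt (show 1 < p from hp)] at h

/-- **Lucas's criterion for one line**: a valid line all of whose `qs` are prime has a prime head.
[cite: Pratt1975, pp. 214–220] -/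
theorem LineValid.prime {H : Set ℕ} {l : Line} (hl : LineValid H l) (hq : ∀ q ∈ l.2.2, q.Prime) :
    l.1.Prime := by
  obtain ⟨p, g, qs⟩ := l
  obtain ⟨h2, hpow, hprod, hqs⟩ := hl
  dsimp only at h2 hpow hprod hqs hq
  refine lucas_primality p (g : ZMod p) (zmod_pow_eq_one_of_mod hpow) fun r hr hrd => ?_
  have hrmem : r ∈ qs := by
    rw [← hprod] at hrd
    exact mem_list_primes_of_dvd_prod hr.prime (fun q hq' => (hq q hq').prime) hrd
  intro h1
  exact (hqs r hrmem).2 (mod_eq_one_of_zmod_pow h2 h1)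

/-- In a valid line, every `q ∈ qs` is below the head. [folklore] -/
theorem LineValid.lt_of_mem {H : Set ℕ} {l : Line} (hl : LineValid H l) {q : ℕ} (hq : q ∈ l.2.2) :
    q < l.1 := by
  obtain ⟨h2, -, hprod, hqs⟩ := hl
  have hq0 : ∀ r ∈ l.2.2, 0 < r := by
    intro r hr
    rcases Nat.eq_zero_or_pos r with rfl | h
    · exfalso
      have : l.2.2.prod = 0 := List.prod_eq_zero hr
      omega
    · exact h
  have hdvd : q ∣ l.2.2.prod := List.dvd_prod hq
  rw [hprod] at hdvd
  have := Nat.le_of_dvd (by omega) hdvd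
  omega

/-- **Soundness** (Pratt 1975, Thm 1): every head of a valid certificate is prime. By strong
induction on the head: the primes used by a line are smaller heads. [cite: Pratt1975, pp. 214–220] -/
theorem CertValid.prime_of_mem {ls : List Line} (h : CertValid ls) {l : Line} (hl : l ∈ ls) :
    l.1.Prime := by
  suffices key : ∀ n : ℕ, ∀ l ∈ ls, l.1 = n → l.1.Prime from key l.1 l hl rfl
  intro n
  induction n using Nat.strong_induction_on with
  | _ n ih =>
    intro l hl hn
    have hv := h l hl
    refine hv.prime fun q hq => ?_
    obtain ⟨l', hl', hq'⟩ := (hv.2.2.2 q hq).1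
    rw [← hq']
    exact ih _ (by rw [hq', ← hn]; exact hv.lt_of_mem hq) l' hl' rfl

/-- Soundness for heads: every available prime of a valid certificate is prime. [cite: Pratt1975, pp. 214–220] -/
theorem CertValid.prime_of_mem_heads {ls : List Line} (h : CertValid ls) {q : ℕ} (hq : q ∈ heads ls) :
    q.Prime := by
  obtain ⟨l, hl, rfl⟩ := hq
  exact h.prime_of_mem hl

/-! ### Completeness: the lines of the Lucas tree -/

/-- A Lucas witness for `p`: for a prime `p`, (the least residue of) an element `g` with
`g^{p−1} = 1` and `g^{(p−1)/q} ≠ 1` in `ZMod p` for all primes `q ∣ p − 1`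
(`reverse_lucas_primality`, i.e. a primitive root); `0` otherwise. [cite: Pratt1975, pp. 214–220] -/
noncomputable def lucasWitness (p : ℕ) : ℕ :=
  if hp : p.Prime then ((reverse_lucas_primality p hp).choose : ZMod p).val else 0

/-- The Lucas witness is a residue: `lucasWitness p < p` for `p ≠ 0`. [folklore] -/
theorem lucasWitness_lt {p : ℕ} (hp : p ≠ 0) : lucasWitness p < p := by
  unfold lucasWitness
  split_ifs with h
  · have : NeZero p := ⟨hp⟩
    exact ZMod.val_lt _
  · exact Nat.pos_of_ne_zero hp

/-- The defining property of the Lucas witness of a prime. [cite: Pratt1975, pp. 214–220] -/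
theorem lucasWitness_spec {p : ℕ} (hp : p.Prime) :
    lucasWitness p ^ (p - 1) % p = 1 ∧
      ∀ q : ℕ, q.Prime → q ∣ p - 1 → lucasWitness p ^ ((p - 1) / q) % p ≠ 1 := by
  have : NeZero p := ⟨hp.ne_zero⟩
  have hg : (lucasWitness p : ZMod p) = (reverse_lucas_primality p hp).choose := by
    unfold lucasWitness
    rw [dif_pos hp, ZMod.natCast_zmod_val]
  obtain ⟨h1, h2⟩ := (reverse_lucas_primality p hp).choose_spec
  refine ⟨mod_eq_one_of_zmod_pow hp.two_le (by rw [hg]; exact h1), fun q hq hqd h => ?_⟩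
  exact h2 q hq hqd (by rw [← hg]; exact zmod_pow_eq_one_of_mod h)

/-- The line of `p` in its Lucas tree: `(p, lucasWitness p, primeFactorsList (p − 1))`. [cite: Pratt1975, pp. 214–220] -/
noncomputable def line (p : ℕ) : Line := (p, lucasWitness p, (p - 1).primeFactorsList)

/-- The lines of the Lucas tree of `p`, with fuel: the line of `p`, then the trees of the prime
factors of `p − 1` (with multiplicity; duplicate lines are harmless). [cite: CrandallPomerance1999, §4.1.3 (Lucas tree)] -/
noncomputable def linesF : ℕ → ℕ → List Line
  | 0, _ => []
  | fuel + 1, p => line p :: (p - 1).primeFactorsList.flatMap (linesF fuel)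

/-- **The Pratt certificate of `p`**: the lines of its Lucas tree (fuel `p` suffices, the tree
having height `< p`). [cite: CrandallPomerance1999, §4.1.3 (Lucas tree)] -/
noncomputable def lines (p : ℕ) : List Line := linesF p p

/-- A prime factor of `p − 1` is below `p`. [folklore] -/
theorem lt_of_mem_primeFactorsList_sub_one {p q : ℕ} (hq : q ∈ (p - 1).primeFactorsList) : q < p := by
  have h1 := Nat.le_of_mem_primeFactorsList hq
  have h2 : p - 1 ≠ 0 := (Nat.mem_primeFactorsList'.1 hq).2.2
  omega

/-- Enough fuel: `linesF fuel p` does not depend on `fuel ≥ p`. [folklore] -/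
theorem linesF_eq_of_le : ∀ (fuel : ℕ) {p : ℕ}, p ≤ fuel → 0 < p → linesF fuel p = lines p := by
  suffices key : ∀ (fuel fuel' : ℕ) {p : ℕ}, p ≤ fuel → p ≤ fuel' → 0 < p →
      linesF fuel p = linesF fuel' p from
    fun fuel p h hp => key fuel p h le_rfl hp
  intro fuel
  induction fuel with
  | zero => intro fuel' p h _ hp; omega
  | succ fuel ih =>
    intro fuel' p h h' hp
    obtain ⟨fuel', rfl⟩ : ∃ f, fuel' = f + 1 := ⟨fuel' - 1, by omega⟩
    simp only [linesF, List.cons.injEq, true_and]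
    refine List.flatMap_congr fun q hq => ?_
    have hq' := lt_of_mem_primeFactorsList_sub_one hq
    exact ih fuel' (by omega) (by omega) (Nat.prime_of_mem_primeFactorsList hq).pos

/-- **Unfolding the certificate**: the line of `p`, then the certificates of the prime factors of
`p − 1`. [cite: CrandallPomerance1999, §4.1.3 (Lucas tree)] -/
theorem lines_eq {p : ℕ} (hp : 0 < p) :
    lines p = line p :: (p - 1).primeFactorsList.flatMap lines := by
  obtain ⟨n, rfl⟩ : ∃ n, p = n + 1 := ⟨p - 1, by omega⟩
  rw [lines, linesF]
  simp only [List.cons.injEq, true_and]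
  refine List.flatMap_congr fun q hq => ?_
  have hq' := lt_of_mem_primeFactorsList_sub_one hq
  exact linesF_eq_of_le n (by omega) (Nat.prime_of_mem_primeFactorsList hq).pos

/-- `p` heads its own certificate. [folklore] -/
theorem line_mem_lines {p : ℕ} (hp : 0 < p) : line p ∈ lines p := by
  rw [lines_eq hp]; exact List.mem_cons_self

/-- `p` is a head of its certificate. [folklore] -/
theorem mem_heads_lines {p : ℕ} (hp : 0 < p) : p ∈ heads (lines p) :=
  ⟨line p, line_mem_lines hp, rfl⟩

/-- The certificate of a prime factor of `p − 1` is part of the certificate of `p`. [folklore] -/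
theorem lines_subset_of_mem {p q : ℕ} (hq : q ∈ (p - 1).primeFactorsList) :
    lines q ⊆ lines p := by
  have hp : 0 < p := Nat.pos_of_ne_zero (by rintro rfl; simp at hq)
  rw [lines_eq hp]
  exact fun l hl => List.mem_cons_of_mem _ (List.mem_flatMap.2 ⟨q, hq, hl⟩)

/-- **The shape of the lines** of the certificate of `p`: each is `line r` for some `0 < r ≤ p`.
[cite: CrandallPomerance1999, §4.1.3 (Lucas tree)] -/
theorem mem_lines_iff : ∀ {p : ℕ} (_ : 0 < p) {l : Line},
    l ∈ lines p → ∃ r, 0 < r ∧ r ≤ p ∧ l = line r := by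
  intro p
  induction p using Nat.strong_induction_on with
  | _ p ih =>
    intro hp l hl
    rw [lines_eq hp, List.mem_cons, List.mem_flatMap] at hl
    rcases hl with rfl | ⟨q, hq, hl⟩
    · exact ⟨p, hp, le_rfl, rfl⟩
    · have hq' := lt_of_mem_primeFactorsList_sub_one hq
      obtain ⟨r, hr, hrq, rfl⟩ := ih q hq' (Nat.prime_of_mem_primeFactorsList hq).pos hl
      exact ⟨r, hr, by omega, rfl⟩

/-- The line of a prime is valid as soon as the prime factors of `p − 1` are available.
[cite: Pratt1975, pp. 214–220] -/
theorem lineValid_line {p : ℕ} (hp : p.Prime) {H : Set ℕ} (hH : ∀ q ∈ (p - 1).primeFactorsList, q ∈ H) :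
    LineValid H (line p) := by
  obtain ⟨h1, h2⟩ := lucasWitness_spec hp
  refine ⟨hp.two_le, h1, Nat.prod_primeFactorsList (by have := hp.two_le; omega), fun q hq => ⟨hH q hq, ?_⟩⟩
  exact h2 q (Nat.prime_of_mem_primeFactorsList hq) (Nat.dvd_of_mem_primeFactorsList hq)

/-- **Completeness** (Pratt 1975, Thm 2): the certificate of a prime is valid — every line is valid
with respect to the heads of the certificate. [cite: Pratt1975, pp. 214–220] -/
theorem lineValid_of_mem_lines : ∀ {p : ℕ} (_ : p.Prime) {l : Line},
    l ∈ lines p → LineValid (heads (lines p)) l := by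
  intro p
  induction p using Nat.strong_induction_on with
  | _ p ih =>
    intro hp l hl
    have hp0 := hp.pos
    rw [lines_eq hp0, List.mem_cons, List.mem_flatMap] at hl
    rcases hl with rfl | ⟨q, hq, hl⟩
    · refine lineValid_line hp fun q hq => ?_
      exact heads_mono (lines_subset_of_mem hq) (mem_heads_lines (Nat.prime_of_mem_primeFactorsList hq).pos)
    · have hq' := lt_of_mem_primeFactorsList_sub_one hq
      exact (ih q hq' (Nat.prime_of_mem_primeFactorsList hq) hl).mono (heads_mono (lines_subset_of_mem hq))

/-- The certificate of a prime is a valid certificate. [cite: Pratt1975, pp. 214–220] -/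
theorem certValid_lines {p : ℕ} (hp : p.Prime) : CertValid (lines p) :=
  fun _ hl => lineValid_of_mem_lines hp hl

/-- Validity of a union of certificates of primes (the certificate of a factorisation).
[cite: Pratt1975, pp. 214–220] -/
theorem certValid_flatMap_lines {ps : List ℕ} (hps : ∀ p ∈ ps, p.Prime) :
    CertValid (ps.flatMap lines) := by
  intro l hl
  obtain ⟨p, hp, hl⟩ := List.mem_flatMap.1 hl
  exact (lineValid_of_mem_lines (hps p hp) hl).mono (heads_mono fun l' hl' => List.mem_flatMap.2 ⟨p, hp, hl'⟩)

/-! ### Succinctness: the size of the Lucas tree -/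

/-- A prime `p` with `p − 1` prime is `3`. [folklore] -/
theorem eq_three_of_prime_sub_one {p : ℕ} (hp : p.Prime) (hq : (p - 1).Prime) : p = 3 := by
  rcases hp.eq_two_or_odd with rfl | hodd
  · exact absurd hq (by decide)
  · rcases hq.eq_two_or_odd with h2 | hodd'
    · omega
    · omega

/-- **Pratt's count** (Pratt 1975; Crandall–Pomerance Thm 4.1.9, `N(p) < lg p` for the odd
vertices): the number `n` of lines of the certificate of a prime `p` — the vertices of its Lucas
tree, the prime `2` included, with multiplicity — satisfies `2^{n+1} ≤ p²` (i.e. `n ≤ 2 log₂ p − 1`).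
[cite: CrandallPomerance1999, Thm 4.1.9] -/
theorem two_pow_length_lines_succ_le : ∀ {p : ℕ} (_ : p.Prime),
    2 ^ ((lines p).length + 1) ≤ p ^ 2 := by
  intro p
  induction p using Nat.strong_induction_on with
  | _ p ih =>
    intro hp
    have hp0 := hp.pos
    rw [lines_eq hp0, List.length_cons, List.length_flatMap]
    set qs := (p - 1).primeFactorsList with hqs
    -- the product form of the induction hypothesis over the children
    have key : ∀ rs : List ℕ, (∀ q ∈ rs, q ∈ qs) →
        2 ^ (rs.length + (rs.map fun q => (lines q).length).sum) ≤ (rs.prod) ^ 2 := by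
      intro rs
      induction rs with
      | nil => intro; simp
      | cons r rs ihr =>
        intro hrs
        have hr : r ∈ qs := hrs r List.mem_cons_self
        have hrp := Nat.prime_of_mem_primeFactorsList hr
        have h1 := ih r (lt_of_mem_primeFactorsList_sub_one hr) hrp
        have h2 := ihr fun q hq => hrs q (List.mem_cons_of_mem _ hq)
        simp only [List.length_cons, List.map_cons, List.sum_cons, List.prod_cons]
        have : rs.length + 1 + ((lines r).length + (rs.map fun q => (lines q).length).sum) =
            ((lines r).length + 1) + (rs.length + (rs.map fun q => (lines q).length).sum) := by ring
        rw [this, pow_add, mul_pow]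
        exact Nat.mul_le_mul h1 h2
    have hprod : qs.prod = p - 1 := Nat.prod_primeFactorsList (by have := hp.two_le; omega)
    have hk := key qs fun q hq => hq
    rw [hprod] at hk
    -- case on the number of children
    rcases hlen : qs.length with _ | _ | m
    · -- no prime factor: p - 1 = 1
      have hq1 : p - 1 = 1 := by
        have : qs.prod = 1 := by rw [List.eq_nil_of_length_eq_zero hlen]; rfl
        omega
      have hp2 : p = 2 := by omega
      subst hp2
      rw [List.eq_nil_of_length_eq_zero hlen]
      norm_num
    · -- one prime factor: p - 1 prime, p = 3
      obtain ⟨q, hq⟩ := List.length_eq_one_iff.1 hlen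
      have hqp : (p - 1) = q := by rw [← hprod, hq]; simp
      have hq3 := eq_three_of_prime_sub_one hp (by rw [hqp]; exact Nat.prime_of_mem_primeFactorsList (by rw [← hqs, hq]; simp))
      subst hq3
      have hq2 : q = 2 := by omega
      subst hq2
      rw [hq]
      have h2 : lines 2 = [line 2] := by rw [lines_eq two_pos]; simp
      simp [h2]
    · -- at least two children: the two spare factors of 2 pay for the root
      rw [hlen] at hk
      calc 2 ^ ((qs.map fun a => (lines a).length).sum + 1 + 1)
          ≤ 2 ^ (m + 2 + (qs.map fun q => (lines q).length).sum) :=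
            Nat.pow_le_pow_right two_pos (by omega)
        _ ≤ (p - 1) ^ 2 := by simpa [Nat.add_comm, Nat.add_assoc, Nat.add_left_comm] using hk
        _ ≤ p ^ 2 := Nat.pow_le_pow_left (Nat.sub_le p 1) 2

/-- **Succinctness**: the certificate of a prime `p` has fewer than `2 · size p` lines
(`size p = ⌊log₂ p⌋ + 1` binary digits). [cite: CrandallPomerance1999, Thm 4.1.9] -/
theorem length_lines_lt {p : ℕ} (hp : p.Prime) : (lines p).length + 1 < 2 * p.size := by
  have h1 := two_pow_length_lines_succ_le hp
  have h2 : p ^ 2 < 2 ^ (2 * p.size) := by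
    rw [two_mul, pow_add, Nat.pow_two]
    have := Nat.lt_size_self p
    exact Nat.mul_lt_mul'' this this
  exact (Nat.pow_lt_pow_iff_right one_lt_two).1 (lt_of_le_of_lt h1 h2)

/-- A number `q ≥ 2` has at most `2 log₂ q` binary digits: `2 ^ size q ≤ q²`. [folklore] -/
theorem two_pow_size_le_sq {q : ℕ} (hq : 2 ≤ q) : 2 ^ q.size ≤ q ^ 2 := by
  have hs : 0 < q.size := Nat.size_pos.2 (by omega)
  obtain ⟨k, hk⟩ : ∃ k, q.size = k + 1 := ⟨q.size - 1, by omega⟩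
  have hkq : 2 ^ k ≤ q := Nat.lt_size.1 (by omega)
  have hk1 : 1 ≤ k := by
    by_contra h
    have hk0 : k = 0 := by omega
    rw [hk0] at hk
    have := Nat.size_le.1 hk.le
    omega
  calc 2 ^ q.size = 2 * 2 ^ k := by rw [hk, pow_succ, Nat.mul_comm]
    _ ≤ 2 ^ k * 2 ^ k := Nat.mul_le_mul_right _ (Nat.one_lt_two_pow_iff.2 (by omega))
    _ ≤ q * q := Nat.mul_le_mul hkq hkq
    _ = q ^ 2 := (Nat.pow_two q).symm

/-- **Digit count of a factorisation**: the prime factors of `n` have fewer than `2 · size n` binary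
digits in total (`2^{Σ size q} ≤ ∏ q² = n² < 4^{size n}`). [folklore] -/
theorem sum_size_primeFactorsList_lt {n : ℕ} (hn : n ≠ 0) :
    (n.primeFactorsList.map Nat.size).sum < 2 * n.size := by
  have key : ∀ rs : List ℕ, (∀ q ∈ rs, 2 ≤ q) → 2 ^ (rs.map Nat.size).sum ≤ rs.prod ^ 2 := by
    intro rs
    induction rs with
    | nil => intro; simp
    | cons r rs ih =>
      intro h
      simp only [List.map_cons, List.sum_cons, List.prod_cons, pow_add, mul_pow]
      exact Nat.mul_le_mul (two_pow_size_le_sq (h r List.mem_cons_self)) (ih fun q hq => h q (List.mem_cons_of_mem _ hq))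
  have h1 := key n.primeFactorsList fun q hq => (Nat.prime_of_mem_primeFactorsList hq).two_le
  rw [Nat.prod_primeFactorsList hn] at h1
  have h2 : n ^ 2 < 2 ^ (2 * n.size) := by
    rw [two_mul, pow_add, Nat.pow_two]
    have := Nat.lt_size_self n
    exact Nat.mul_lt_mul'' this this
  exact (Nat.pow_lt_pow_iff_right one_lt_two).1 (lt_of_le_of_lt h1 h2)

/-- The number of prime factors (with multiplicity) is less than the number of binary digits.
[folklore] -/
theorem length_primeFactorsList_lt_size {n : ℕ} (hn : n ≠ 0) : n.primeFactorsList.length < n.size := by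
  have h := sum_size_primeFactorsList_lt hn
  have h2 : 2 * n.primeFactorsList.length ≤ (n.primeFactorsList.map Nat.size).sum := by
    have : ∀ rs : List ℕ, (∀ q ∈ rs, 2 ≤ q) → 2 * rs.length ≤ (rs.map Nat.size).sum := by
      intro rs
      induction rs with
      | nil => intro; simp
      | cons r rs ih =>
        intro hrs
        have hr : 2 ≤ r.size := Nat.lt_size.2 (by simpa using hrs r List.mem_cons_self)
        have := ih fun q hq => hrs q (List.mem_cons_of_mem _ hq)
        simp only [List.length_cons, List.map_cons, List.sum_cons]
        omega
    exact this _ fun q hq => (Nat.prime_of_mem_primeFactorsList hq).two_le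
  omega

end Pratt

end Literature.NumberTheory.Primality
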